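import Summits.MatrixMultiplication.OmegaCensus.STPP222SqNone_5_5A

/-!
# ω-census, the pattern `(2,2,2)²`: NOT in `ZMod 5 × ZMod 5` — search chunks, part B

HONEST FRAMING (pub-omega census; verbatim): lottery ticket; floor = certified bounds/negative ranges.
Census STRUCTURE bookkeeping (Q7 row `k = 2`), not progress on `ω`.  Kernel search chunks 3–8 of 11 for
`STPP222SqNone_5_5.lean` (data `E5_5` / `el5_5` from part A; method in part A's docstring).
-/

open Literature.Computability.AlgebraicComplexity Finset

namespace Summit.MatrixMultiplication.OmegaCensus

namespace STPP222SqNeg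

/-- Start triples, chunk 3 (1 starts, 53870 clause evaluations). [folklore] -/
def reps5_5_3 : List ((ℕ × ℕ) × (ℕ × ℕ) × (ℕ × ℕ) × List (ℕ × ℕ)) :=
  [((0, 1), (0, 2), (1, 0), [(3, 1), (3, 2), (3, 3)])]

/-- Kernel search, chunk 3. [folklore] -/
theorem search5_5_3 : searchB E5_5.ops el5_5 E5_5.key reps5_5_3 = true := by
  decide +kernel

/-- Start triples, chunk 4 (1 starts, 4870 clause evaluations). [folklore] -/
def reps5_5_4 : List ((ℕ × ℕ) × (ℕ × ℕ) × (ℕ × ℕ) × List (ℕ × ℕ)) :=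
  [((0, 1), (0, 2), (1, 0), [(3, 4), (4, 0), (4, 1), (4, 2), (4, 3), (4, 4)])]

/-- Kernel search, chunk 4. [folklore] -/
theorem search5_5_4 : searchB E5_5.ops el5_5 E5_5.key reps5_5_4 = true := by
  decide +kernel

/-- Start triples, chunk 5 (1 starts, 52260 clause evaluations). [folklore] -/
def reps5_5_5 : List ((ℕ × ℕ) × (ℕ × ℕ) × (ℕ × ℕ) × List (ℕ × ℕ)) :=
  [((0, 1), (1, 0), (1, 2), [(0, 0), (0, 1), (0, 2), (0, 3), (0, 4), (1, 0), (1, 1), (1, 2), (1, 3), (1, 4), (2, 0), (2, 1), (2, 2), (2, 3), (2, 4), (3, 0), (3, 1), (3, 2), (3, 3), (3, 4), (4, 0)])]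

/-- Kernel search, chunk 5. [folklore] -/
theorem search5_5_5 : searchB E5_5.ops el5_5 E5_5.key reps5_5_5 = true := by
  decide +kernel

/-- Start triples, chunk 6 (2 starts, 34717 clause evaluations). [folklore] -/
def reps5_5_6 : List ((ℕ × ℕ) × (ℕ × ℕ) × (ℕ × ℕ) × List (ℕ × ℕ)) :=
  [((0, 1), (1, 0), (1, 2), [(4, 1), (4, 2), (4, 3), (4, 4)]), ((0, 1), (1, 0), (2, 0), [(0, 0), (0, 1), (0, 2)])]

/-- Kernel search, chunk 6. [folklore] -/
theorem search5_5_6 : searchB E5_5.ops el5_5 E5_5.key reps5_5_6 = true := by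
  decide +kernel

/-- Start triples, chunk 7 (1 starts, 52644 clause evaluations). [folklore] -/
def reps5_5_7 : List ((ℕ × ℕ) × (ℕ × ℕ) × (ℕ × ℕ) × List (ℕ × ℕ)) :=
  [((0, 1), (1, 0), (2, 0), [(0, 3), (0, 4), (1, 0), (1, 1)])]

/-- Kernel search, chunk 7. [folklore] -/
theorem search5_5_7 : searchB E5_5.ops el5_5 E5_5.key reps5_5_7 = true := by
  decide +kernel

/-- Start triples, chunk 8 (1 starts, 42851 clause evaluations). [folklore] -/
def reps5_5_8 : List ((ℕ × ℕ) × (ℕ × ℕ) × (ℕ × ℕ) × List (ℕ × ℕ)) :=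
  [((0, 1), (1, 0), (2, 0), [(1, 2), (1, 3), (1, 4), (2, 0), (2, 1), (2, 2)])]

/-- Kernel search, chunk 8. [folklore] -/
theorem search5_5_8 : searchB E5_5.ops el5_5 E5_5.key reps5_5_8 = true := by
  decide +kernel

end STPP222SqNeg

end Summit.MatrixMultiplication.OmegaCensus
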